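import Mathlib.NumberTheory.LegendreSymbol.JacobiSymbol
import Literature.NumberTheory.LFunctions.FeketePolynomial
import HarnessLib

set_option linter.dupNamespace false -- `Summit.BirchSwinnertonDyer.BirchSwinnertonDyer.Theorems.…` (summit = sub)
set_option autoImplicit false

/-!
# Crux `HeegnerTwistCouplingInSupply` (stmt-BirchSwinnertonDyer-21381) — card `linnik-sieve-residual-census`:
# the AMPLIFIER SIGN and the non-residue class count (kernel lemmas for the Linnik census)

Route `BiquadraticEisensteinDescent` (cell `pub/bsd-wall`, width seat `bsd-wall-cm-bed-w3` g19; `--supports` 21381, helper).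
The crux idea card `Cruxes/HeegnerTwistCouplingInSupply/Ideas/linnik-sieve-residual-census.md` (crux-ideate seat 2, g25)
makes the corner prime `p` the MODULUS of a large-sieve family: a located-prime residual of the cell/ladder layer has the shape
«no prime `ℓ ≤ y` in the class `7 (mod 16)` with `(p/ℓ) = +1`», and on such an exceptional `p ≡ 5 (mod 8)` the Legendre symbol
of every integer `n` built from class-`7 (mod 16)` primes `≤ y` is the `p`-INDEPENDENT sign `(−1)^{Ω(n)}` (reciprocity at
`p ≡ 1 (mod 4)` plus multiplicativity). This file proves exactly that — the card's `AmplifierSign p y`, BY VALUE, for all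
`p, y` (`amplifierSign`) — together with the two counting facts the arithmetic large sieve consumes in the companion file
`…LinnikCensus.lean`: a product of an EVEN number of such primes is a non-zero quadratic residue mod `p`
(`jacobiSym_finsetProd_of_forall_eq_neg_one`, `natMod_not_mem_nonResidueClasses`), and at least half of the classes mod an
odd prime `p` are NOT non-zero quadratic residues (`natCast_le_two_mul_card_nonResidueClasses`, from
`Σ_{h<p} (h/p) = 0`, the tree's `Literature.NumberTheory.LFunctions.sum_range_legendreSym`).

HONEST FRAMING: elementary support lemmas for a RUNG-LEVEL corner census (j = 8000, `p ≡ 5 (mod 8)` rung); the crux as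
stated (C⁺), its registered stubs and BSD are NOT touched; nothing is closed by this file. THEOREMS ONLY (no `def`).
-/

namespace Summit.BirchSwinnertonDyer.BirchSwinnertonDyer.Theorems.LinnikCensus

open Finset

/-! ## Reciprocity at `p ≡ 1 (mod 4)`: no located prime ⇒ every located-class prime is a non-residue mod `p` -/

/-- For distinct primes `p, ℓ`, `(p/ℓ) ≠ 1` forces `(p/ℓ) = −1` (the symbol of a unit is `±1`). [folklore] -/
theorem jacobiSym_eq_neg_one_of_ne_one {p ℓ : ℕ} (hp : p.Prime) (hℓ : ℓ.Prime) (hne : ℓ ≠ p)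
    (h : jacobiSym (p : ℤ) ℓ ≠ 1) : jacobiSym (p : ℤ) ℓ = -1 := by
  have hcop : Int.gcd (p : ℤ) ℓ = 1 := by
    rw [Int.gcd_natCast_natCast]
    exact (Nat.coprime_primes hp hℓ).mpr (Ne.symm hne)
  rcases jacobiSym.eq_one_or_neg_one hcop with h1 | h1
  · exact absurd h1 h
  · exact h1

/-- For `p ≡ 1 (mod 4)` prime and an odd prime `ℓ ≠ p` with `(p/ℓ) ≠ 1`: `(ℓ/p) = −1` (quadratic reciprocity in the
sign-free case `p ≡ 1 (mod 4)`). [folklore] -/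
theorem jacobiSym_swap_eq_neg_one {p ℓ : ℕ} (hp : p.Prime) (hp4 : p % 4 = 1) (hℓ : ℓ.Prime) (hℓ2 : ℓ ≠ 2)
    (hne : ℓ ≠ p) (h : jacobiSym (p : ℤ) ℓ ≠ 1) : jacobiSym (ℓ : ℤ) p = -1 := by
  have h1 := jacobiSym_eq_neg_one_of_ne_one hp hℓ hne h
  have hodd : Odd ℓ := hℓ.odd_of_ne_two hℓ2
  rwa [jacobiSym.quadratic_reciprocity_one_mod_four hp4 hodd] at h1

/-! ## Multiplicativity: the amplifier sign -/

/-- If every member of a list of naturals is a non-residue mod `b`, the symbol of the product is `(−1)^{length}`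
(multiplicativity of the Jacobi symbol in the numerator). [folklore] -/
theorem jacobiSym_listProd_of_forall_eq_neg_one {b : ℕ} :
    ∀ l : List ℕ, (∀ q ∈ l, jacobiSym (q : ℤ) b = -1) →
      jacobiSym ((l.prod : ℕ) : ℤ) b = (-1) ^ l.length
  | [], _ => by simp [jacobiSym.one_left]
  | q :: l, h => by
      have hq : jacobiSym (q : ℤ) b = -1 := h q (by simp)
      have hl : ∀ r ∈ l, jacobiSym (r : ℤ) b = -1 := fun r hr => h r (by simp [hr])
      rw [List.prod_cons, Nat.cast_mul, jacobiSym.mul_left, List.length_cons, pow_succ, hq,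
        jacobiSym_listProd_of_forall_eq_neg_one l hl]
      ring

/-- If every member of a finset of naturals is a non-residue mod `b`, the symbol of the product is `(−1)^{card}`.
[folklore] -/
theorem jacobiSym_finsetProd_of_forall_eq_neg_one {b : ℕ} (s : Finset ℕ)
    (h : ∀ q ∈ s, jacobiSym (q : ℤ) b = -1) :
    jacobiSym ((∏ q ∈ s, q : ℕ) : ℤ) b = (-1) ^ s.card := by
  induction s using Finset.cons_induction with
  | empty => simp [jacobiSym.one_left]
  | cons a s ha ih =>
      rw [Finset.prod_cons, Nat.cast_mul, jacobiSym.mul_left, Finset.card_cons, pow_succ,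
        h a (Finset.mem_cons_self a s), ih (fun q hq => h q (Finset.mem_cons.mpr (Or.inr hq)))]
      ring

/-- ★ **The amplifier sign** — the card's `AmplifierSign p y`, by value, for ALL `p, y`: on an exceptional prime
`p ≡ 5 (mod 8)` (`y < p`, no located prime: every prime `ℓ ≤ y`, `ℓ ≡ 7 (mod 16)` has `(p/ℓ) ≠ +1`), every `n > 0` all of
whose prime factors are `≤ y` and `≡ 7 (mod 16)` has `(n/p) = (−1)^{Ω(n)}` (`Ω(n) = n.primeFactorsList.length`). Proof: each
prime factor `q` of `n` has `(p/q) = −1` (unit symbol `≠ 1`), hence `(q/p) = −1` by reciprocity at `p ≡ 1 (mod 4)`; multiply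
over `n.primeFactorsList`. [folklore] -/
theorem amplifierSign (p y : ℕ) :
    p.Prime → p % 8 = 5 → y < p →
      (∀ ℓ : ℕ, ℓ.Prime → ℓ % 16 = 7 → ℓ ≤ y → jacobiSym (p : ℤ) ℓ ≠ 1) →
        ∀ n : ℕ, 0 < n → (∀ q ∈ n.primeFactors, q ≤ y ∧ q % 16 = 7) →
          jacobiSym (n : ℤ) p = (-1) ^ n.primeFactorsList.length := by
  intro hp hp8 hyp hno n hn hfac
  have key : ∀ q ∈ n.primeFactorsList, jacobiSym (q : ℤ) p = -1 := by
    intro q hq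
    have hqprime : q.Prime := Nat.prime_of_mem_primeFactorsList hq
    have hqmem : q ∈ n.primeFactors := Nat.mem_primeFactors_iff_mem_primeFactorsList.mpr hq
    obtain ⟨hqy, hq16⟩ := hfac q hqmem
    exact jacobiSym_swap_eq_neg_one hp (by omega) hqprime (by omega) (by omega) (hno q hqprime hq16 hqy)
  have h := jacobiSym_listProd_of_forall_eq_neg_one n.primeFactorsList key
  rwa [Nat.prod_primeFactorsList hn.ne'] at h

/-- **Amplifier elements are non-zero quadratic residues**: on an exceptional `p ≡ 5 (mod 8)` (no located prime `≤ y`;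
`q ≠ p` is automatic from `q ≡ 7`, `p ≡ 5 (mod 8)`), the product of a finset `s` of primes `q ≤ y`, `q ≡ 7 (mod 16)`, with `#s` even has `(∏ s / p) = +1`.
[folklore] -/
theorem jacobiSym_finsetProd_eq_one_of_even {p y : ℕ} (hp : p.Prime) (hp8 : p % 8 = 5)
    (hno : ∀ ℓ : ℕ, ℓ.Prime → ℓ % 16 = 7 → ℓ ≤ y → jacobiSym (p : ℤ) ℓ ≠ 1)
    (s : Finset ℕ) (hs : ∀ q ∈ s, q.Prime ∧ q ≤ y ∧ q % 16 = 7) (heven : Even s.card) :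
    jacobiSym ((∏ q ∈ s, q : ℕ) : ℤ) p = 1 := by
  have key : ∀ q ∈ s, jacobiSym (q : ℤ) p = -1 := by
    intro q hq
    obtain ⟨hqprime, hqy, hq16⟩ := hs q hq
    exact jacobiSym_swap_eq_neg_one hp (by omega) hqprime (by omega) (by omega) (hno q hqprime hq16 hqy)
  rw [jacobiSym_finsetProd_of_forall_eq_neg_one s key, heven.neg_one_pow]

/-! ## Residue classes: quadratic residues avoid the non-residue classes; at least half the classes are non-residue classes -/

/-- If `(n/p) = +1` then the residue `n % p` is NOT among the classes `h < p` with `(h/p) ≠ 1` (the Jacobi symbol only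
depends on the numerator mod `p`). [folklore] -/
theorem natMod_not_mem_nonResidueClasses {p n : ℕ} (hJ : jacobiSym (n : ℤ) p = 1) :
    n % p ∉ (Finset.range p).filter (fun h : ℕ => jacobiSym (h : ℤ) p ≠ 1) := by
  intro hmem
  rw [Finset.mem_filter] at hmem
  apply hmem.2
  rw [Int.natCast_mod, ← jacobiSym.mod_left]
  exact hJ

/-- `Σ_{h < p} (h/p) = 0` for an odd prime `p`, in Jacobi-symbol dress (the tree's
`Literature.NumberTheory.LFunctions.sum_range_legendreSym`). [folklore] -/
theorem sum_range_jacobiSym_natCast_eq_zero {p : ℕ} (hp : p.Prime) (hp2 : p ≠ 2) :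
    ∑ h ∈ Finset.range p, jacobiSym (h : ℤ) p = 0 := by
  haveI : Fact p.Prime := ⟨hp⟩
  have h := Literature.NumberTheory.LFunctions.sum_range_legendreSym p hp2
  simpa only [jacobiSym.legendreSym.to_jacobiSym] using h

/-- **At least half of the classes mod an odd prime are not non-zero quadratic residues**:
`p ≤ 2 · #{h < p : (h/p) ≠ 1}` (there are as many residues as non-residues, plus the class `0`; from `Σ_{h<p} (h/p) = 0`
and `(h/p) ≥ −1`). [folklore] -/
theorem natCast_le_two_mul_card_nonResidueClasses {p : ℕ} (hp : p.Prime) (hp2 : p ≠ 2) :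
    (p : ℝ) ≤ 2 * (((Finset.range p).filter (fun h : ℕ => jacobiSym (h : ℤ) p ≠ 1)).card : ℝ) := by
  set A := (Finset.range p).filter (fun h : ℕ => jacobiSym (h : ℤ) p ≠ 1) with hA
  set B := (Finset.range p).filter (fun h : ℕ => ¬ jacobiSym (h : ℤ) p ≠ 1) with hB
  have hcard : A.card + B.card = p := by
    rw [hA, hB, Finset.card_filter_add_card_filter_not, Finset.card_range]
  have hsplit : ∑ h ∈ Finset.range p, jacobiSym (h : ℤ) p =
      ∑ h ∈ A, jacobiSym (h : ℤ) p + ∑ h ∈ B, jacobiSym (h : ℤ) p :=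
    (Finset.sum_filter_add_sum_filter_not _ _ _).symm
  have hBsum : ∑ h ∈ B, jacobiSym (h : ℤ) p = B.card := by
    rw [Finset.card_eq_sum_ones, Nat.cast_sum, Nat.cast_one]
    refine Finset.sum_congr rfl fun h hh => ?_
    rw [hB, Finset.mem_filter, not_not] at hh
    exact hh.2
  have hAsum : -(A.card : ℤ) ≤ ∑ h ∈ A, jacobiSym (h : ℤ) p := by
    have hterm : ∀ h ∈ A, (-1 : ℤ) ≤ jacobiSym (h : ℤ) p := by
      intro h _
      rcases jacobiSym.trichotomy (h : ℤ) p with h0 | h0 | h0 <;> rw [h0] <;> norm_num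
    calc -(A.card : ℤ) = ∑ h ∈ A, (-1 : ℤ) := by simp
      _ ≤ ∑ h ∈ A, jacobiSym (h : ℤ) p := Finset.sum_le_sum hterm
  have hzero := sum_range_jacobiSym_natCast_eq_zero hp hp2
  rw [hsplit, hBsum] at hzero
  have hBA : (B.card : ℤ) ≤ A.card := by linarith
  have hBA' : B.card ≤ A.card := by exact_mod_cast hBA
  have : p ≤ 2 * A.card := by omega
  exact_mod_cast this

/-- The non-residue classes are a PROPER subset of the classes: `#{h < p : (h/p) ≠ 1} < p` (the class `1` is a residue).
[folklore] -/
theorem card_nonResidueClasses_lt {p : ℕ} (hp : p.Prime) :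
    ((Finset.range p).filter (fun h : ℕ => jacobiSym (h : ℤ) p ≠ 1)).card < p := by
  have h1 : 1 ∈ Finset.range p := Finset.mem_range.mpr hp.one_lt
  have h1' : 1 ∉ (Finset.range p).filter (fun h : ℕ => jacobiSym (h : ℤ) p ≠ 1) := by
    rw [Finset.mem_filter, not_and, not_not]
    intro _
    exact_mod_cast jacobiSym.one_left p
  calc ((Finset.range p).filter (fun h : ℕ => jacobiSym (h : ℤ) p ≠ 1)).card
      < (Finset.range p).card :=
        Finset.card_lt_card ⟨Finset.filter_subset _ _, fun hsub => h1' (hsub h1)⟩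
    _ = p := Finset.card_range p

end Summit.BirchSwinnertonDyer.BirchSwinnertonDyer.Theorems.LinnikCensus
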